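import Summits.ABC.IUTFork.DAGC312p

/-!
# Kernel DAG index — layer C312, part s: knitting DELTA 10 — at the readings of record the value granted to the opaque locus (SHE)
never reaches the one remaining node

index v1 · abc-iut-c312-2 (filer, gen 3) per HOME/plan/KERNEL-DAG-SPEC.md v1.3 §2(e). PROOF-ONLY, APPEND-ONLY (imports part p; nothing
redefined). A census fact about the typed chain, recorded because the loci census (parts n/o/q) ends with exactly ONE opaque locus — (SHE),
Rmk 3.11.1 (iii), cited at (xi-b)–(xi-e) — and the step census (part p) ends with exactly ONE undischarged node — (xi-f):

* `xi_f_node_indep_pending` — for ANY two assignments `pending`, `pending'` (in particular (SHE) granted vs. refused), the (xi-f) node under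
  the readings of record has the SAME truth value: it cites no locus (`Step.xi_f_data`) and the two observations it invokes are read, at the
  readings of record, as properties of the verbatim setting `P` alone (abc-iut-c312-4's `DisplayXIeReal`, `SheMeansFixedValueReal`).
* `chain_indep_pending` — given the named side data of part p, the whole twenty-node chain under the readings of record has the same truth
  value for any two `pending` (both sides are equivalent to the typed Statement, `chain_of_record_iff_statement`).
* `she_passes_through` — where (SHE) IS consulted: (xi-b)'s observation "the output satisfies (IPL), (SHE)" is read as `S.link.IPL ∧ pending .SHE`
  and (xi-b), (xi-c) hold for every `pending` (part p) — the locus travels as pass-through text into `displayXIc`, and (xi-d)/(xi-e) read their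
  observations on `P`, not on it.
Neutral record: for the reading that the gloss does no inferential work in the printed chain, and equally for the reading that the content of
Step (xi) sits in the CONSTRUCTION of the multiradial representation (the setting `P`, typed by abc-iut-c312-7 / L6) rather than in the chain,
this is the same kernel fact. THIS FILE PROVES NOTHING NEW about [IUTchIII] §3 AND ASSERTS NOTHING; no side taken on Cor. 3.12.
typed ≠ discharged; indexed ≠ endorsed. [claim: Mochizuki2012, status: disputed]
-/

noncomputable section

namespace Summit.ABC.IUTFork.DAG

open Cor312Proof Thm311 StepXI Literature.IUT.LogThetaLattice

variable {T : ThetaIndex} (S : FullSituation T) (pending pending' : Locus → Prop) (P : Cor312.Setting S.toSituation)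
  (D : ThetaLinkStrips P.LogLink P.Strip)

/-- **The (xi-f) node's truth value at the readings of record does not depend on what is granted at any locus** — in particular not on
(SHE): both sides unfold to "`P.DisplayXIeReal → P.SheMeansFixedValueReal → ↑(−|log(q)|) ≤ −|log(Θ)|`". [folklore] -/
theorem xi_f_node_indep_pending :
    N_IUTchIII_Cor3_12_pf_xi_f (lociReadingI S pending) (obsReadingA S pending P D) ↔
      N_IUTchIII_Cor3_12_pf_xi_f (lociReadingI S pending') (obsReadingA S pending' P D) :=
  (N_IUTchIII_Cor3_12_pf_xi_f_iff S pending P D).trans (N_IUTchIII_Cor3_12_pf_xi_f_iff S pending' P D).symm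

/-- **Given the named side data, the twenty-node chain's truth value at the readings of record does not depend on `pending` either** (both
sides ↔ the typed Statement). [folklore] -/
theorem chain_indep_pending
    (hIndAdm : ∀ Φ ∈ S.L.Ind1Family ∪ S.L.Ind2Family, ∀ (j : T.Label) (vQ : T.VQ) (A : Set (S.L.Packet j vQ)),
      (S.D P.n).Adm j vQ A ↔ (S.D P.n).Adm j vQ (Φ j vQ '' A))
    (hIndVol : (S.D P.n).LogvolInvariant)
    (hMono : ∀ (j : T.Label) (vQ : T.VQ) (A B : Set (S.L.Packet j vQ)),
      (S.D P.n).Adm j vQ A → (S.D P.n).Adm j vQ B → A ⊆ B → (S.D P.n).logvol j vQ A ≤ (S.D P.n).logvol j vQ B)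
    (hNE : ∀ n m : ℤ, Nonempty (P.IsoS (D.stripLGP (P.lattice.logLink n (m - 1))) (D.stripDelta (P.lattice.theater (n + 1) m))))
    (hfin : P.ThetaFinite) (hqpos : P.AbsLogQPos) :
    N_IUTchIII_Cor3_12_pf (lociReadingI S pending) (obsReadingA S pending P D) ↔
      N_IUTchIII_Cor3_12_pf (lociReadingI S pending') (obsReadingA S pending' P D) :=
  (chain_of_record_iff_statement S pending P D hIndAdm hIndVol hMono hNE hfin hqpos).trans
    (chain_of_record_iff_statement S pending' P D hIndAdm hIndVol hMono hNE hfin hqpos).symm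

/-- **Where (SHE) is consulted, it passes through**: (xi-b)'s "the output satisfies (IPL), (SHE)" is read as `S.link.IPL ∧ pending .SHE`, and
the nodes (xi-b), (xi-c) that carry it hold for EVERY `pending` (part p). [folklore] -/
theorem she_passes_through :
    obsReadingA S pending P D .outputSatisfiesIPLSHE = OutputIPLSHE S.link.IPL (pending .SHE) ∧
    N_IUTchIII_Cor3_12_pf_xi_b (lociReadingI S pending) (obsReadingA S pending P D) ∧
    N_IUTchIII_Cor3_12_pf_xi_c (lociReadingI S pending) (obsReadingA S pending P D) :=
  ⟨rfl, N_IUTchIII_Cor3_12_pf_xi_b_holds S pending P D, N_IUTchIII_Cor3_12_pf_xi_c_holds S pending P D⟩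

/-- The steps citing (SHE) are exactly (xi-b)–(xi-e) (part o's census, by `decide`), all four discharged outright or under the Statement's
own side clauses at the readings of record (part p) — so refusing (SHE) blocks none of them as INFERENCES; it only changes the text passed
through. [folklore] -/
theorem she_citing_steps_discharged (hfin : P.ThetaFinite) (hqpos : P.AbsLogQPos) :
    (Step.all.filter fun s => decide (Locus.SHE ∈ s.cites)) = [.xi_b, .xi_c, .xi_d, .xi_e] ∧
    N_IUTchIII_Cor3_12_pf_xi_b (lociReadingI S pending) (obsReadingA S pending P D) ∧
    N_IUTchIII_Cor3_12_pf_xi_c (lociReadingI S pending) (obsReadingA S pending P D) ∧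
    N_IUTchIII_Cor3_12_pf_xi_d (lociReadingI S pending) (obsReadingA S pending P D) ∧
    N_IUTchIII_Cor3_12_pf_xi_e (lociReadingI S pending) (obsReadingA S pending P D) :=
  ⟨by decide, N_IUTchIII_Cor3_12_pf_xi_b_holds S pending P D, N_IUTchIII_Cor3_12_pf_xi_c_holds S pending P D,
    N_IUTchIII_Cor3_12_pf_xi_d_holds_of S pending P D hfin hqpos, N_IUTchIII_Cor3_12_pf_xi_e_holds S pending P D⟩

end Summit.ABC.IUTFork.DAG

end
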